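import Summits.BirchSwinnertonDyer.Rank1Residual.X11a.SelmerCompanionAgreeCertificates
import Literature.NumberTheory.EllipticCurves.BSDRankZeroDensity
import Literature.NumberTheory.EllipticCurves.SelmerCorankControlRatProofs
import HarnessLib

/-!
# Route (3e) SELMER COMPANION, XXXVI: SHAPE F — an AUXILIARY third congruent curve decides the
# two-loss cells (class X11a = N7; cell `b2b-bsdres`, unit `b2b-bsdres-x11a`, gen 32)

HONEST FRAMING (run/shared/lean/b2b/bsd-rank1-residual/, verbatim in every file): the goal of the
cell is to DELETE the COMBINATION-SHAPED residual classes of the Birch–Swinnerton-Dyer formula for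
ALL analytic-rank `≤ 1` elliptic curves over `ℚ` — "full BSD formula for every rank `≤ 1` curve in
class `C`" assembled STRICTLY from published theorems — so that the rank-`≤ 1` remainder becomes
exactly the CONSTRUCTION-SHAPED classes, which are TYPED (missing-input `Prop`s), NOT attempted.
This is not "finishing BSD". CLASS-OWNERS.md: research routes; NO CLAIM BEYOND STATED CLASSES.
THEOREMS ONLY; nothing booked; no label moves. CONDITIONAL on the PUBLISHED binders GZK (`hGZK`),
Cassels–Tate (`hCT`), Tate uniformisation (`hU` = A40, `hU2` = A41), Tate's local Euler
characteristic (`hEP`, Milne *ADT* I Thm. 2.8), and on the per-pair finite data named.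

## What this file proves

Census v10 (gen 31) left the class-(A) cells: a rank-`0` curve `E` with a CLOSED rank-`0` partner
`A₀` (`BSD(A₀,p)`, `p ∤ #Ш_an(A₀)`, `A₀[p]` irreducible, so `Sel^(p)(A₀/ℚ) = 0`, file II) whose
local conditions along `E[p] ≅ A₀[p]` disagree at exactly TWO places, `p` (`E` split multiplicative,
`A₀` good) and a level-lowering place `ℓ₀` (`E` split multiplicative, `A₀` good, `p ∤ ℓ₀ − 1`): then
`dim Sel_p(E) ∈ {0, 2}` is not decided by `A₀`. SHAPE F decides it with ONE auxiliary global class,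
the Kummer class of a rational point `g` of a THIRD curve `F` with `F[p] ≅ E[p]` (for `p = 3` any
non-singular member of the Hesse pencils `X_E(3)`, `X_E^-(3) ≅ ℙ¹` — the tree's PROVED
`Fisher2012.threeCongruent_of_hesseCertificate_unconditional` /
`…_of_dualHesseCertificate_unconditional` supply the equivariant `θ`), chosen split multiplicative
at `p` (like `E`) and GOOD at `ℓ₀` (like `A₀`):

* `natCard_selmerGroup_eq_prime_of_le` — a `p`-Selmer group of order `≤ p` containing a non-zero
  class has order exactly `p` (`H¹(ℚ, F[p])` is killed by `p`, tree
  `Literature.NumberTheory.EllipticCurves.zsmul_galH1Torsion_eq_zero`; finiteness X.4.2(b), tree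
  `finite_selmerGroup_holds`).
* `bsdp_of_auxiliary_of_residue_certificate` — **SHAPE F**: with `θ : E[p] ≃ F[p]` and
  `θ₀ : F[p] ≃ A₀[p]` equivariant, abstract agreement (`hagree₁` for `E ~ F` off `T₁`, `hagree₂`
  for `F ~ A₀` off `T₂ ∪ {(p)}`: kind (i) or any kind lemma, files I–XXXI), `E` SPLIT and `F` GOOD
  at `v₀ ∋ ℓ₀`, `F` MULTIPLICATIVE and `A₀` GOOD at `p`, budgets `∏_{T₁} ≤ p`, `p·∏_{T₂} ≤ p`, and the
  residue certificate `#F̃(𝔽_{ℓ₀}) = p·n ∧ n • red₀ g ≠ 0` for a rational point `g ∈ F(ℚ)`: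
  `BSD(E,p)`. PROOF: `#Sel^(p)(F) ≤ #Sel^(p)(A₀)·p·∏_{T₂} ≤ p` by the strict count at `p` of file
  XXVII (`natCard_selmerGroup_le_of_agree_strict_at_p_rat`, index `≤ p` at `p` from file XIX; its
  strictness hypothesis is vacuous because `Sel^(p)(A₀) = 0`); the certificate gives
  `g ∉ p·F(ℚ_{ℓ₀})` (file XXIII `not_zsmul_of_residue_certificate`), so `κ(g) ∈ Sel^(p)(F)`
  restricts non-trivially at `ℓ₀` (file XXII) and `#Sel^(p)(F) = p`; then shape D with abstract
  agreement (file XXVII `bsdp_of_selmerCompanion_agree_kill`: kill at `v₀` by file XIV, strictness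
  by file XXII `strict_away_of_generator_certificate`) gives `#Sel^(p)(E) ≤ p`, and Cassels–Tate +
  GZK give `BSD(E,p)` (file II). NO hypothesis `BSD(F,p)`, no rank or `Ш` hypothesis on `F`, no
  main conjecture, no `μ`.

Per-pair inputs of record: BSD(A₀,p) (ledger), `r_an`, `#Ш_an`, Irr for `E` and `A₀`; C1 twice
(`θ`, `θ₀`; for `p = 3` from the Hesse certificates); the place kinds; the reduction types of `F` at
`p` and `ℓ₀`; the rational point `g` and the residue certificate at `ℓ₀` (census code
`code/b2b-bsdres-x11a/gen32/shapeF.gp`). Not a class theorem; nothing booked.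

References: [MazurRubin2004] §2.3; [Miller2011LMS] Def. 1.1; [SilvermanAEC2009] VII.2.1,
VIII.§2, X.§4 Thm. X.4.2; [SilvermanATAEC1994] V.3.1, V.5.3; [GrossLMS1991] (7.1);
[Fisher2012Hessian] Thm. 13.2; files II, XIII, XIV, XIX, XXII, XXIII, XXVII, XXVIII;
HOME/b2b-bsdres-x11a/REPORT-g32.md.
-/

set_option autoImplicit false

noncomputable section

open scoped Classical NNReal

open WeierstrassCurve Literature.NumberTheory.EllipticCurves
  Literature.NumberTheory.GaloisRepresentations Field NumberField IsDedekindDomain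
  IsDedekindDomain.HeightOneSpectrum
  Literature.NumberTheory.EllipticCurves.Rank1Residual
  Literature.NumberTheory.EllipticCurves.Rank1Residual.Typed

namespace Summit.BirchSwinnertonDyer.Rank1Residual.X11a.SelmerCompanion

/-! ## §1 A `p`-Selmer group of order `≤ p` with a non-zero class has order `p` -/

/-- **`#Sel^(p) ≤ p` and a non-zero Selmer class give `#Sel^(p) = p`.** The Selmer group is finite
(Silverman X.4.2(b), tree `finite_selmerGroup_holds`) and every class of `H¹(ℚ, A[p])` is killed
by `p` (tree `zsmul_galH1Torsion_eq_zero`), so a non-zero class has additive order `p`, which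
divides the order of the group. [cite: SilvermanAEC2009, Thm X.4.2] -/
theorem natCard_selmerGroup_eq_prime_of_le (A : WeierstrassCurve ℚ) [A.IsElliptic] (p : ℕ)
    [hp : Fact p.Prime] (hle : Nat.card (A.selmerGroup (p : ℤ)) ≤ p)
    {s : galH1Torsion A (p : ℤ)} (hs : s ∈ A.selmerGroup (p : ℤ)) (hs0 : s ≠ 0) :
    Nat.card (A.selmerGroup (p : ℤ)) = p := by
  have hpp : p.Prime := hp.out
  have hn0 : (p : ℤ) ≠ 0 := by exact_mod_cast hpp.ne_zero
  haveI : Finite (A.selmerGroup (p : ℤ)) := A.finite_selmerGroup_holds hn0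
  set x : A.selmerGroup (p : ℤ) := ⟨s, hs⟩ with hx
  have hx0 : x ≠ 0 := fun h ↦ hs0 (congrArg Subtype.val h)
  have hpx : p • x = 0 := by
    apply Subtype.ext
    change p • s = 0
    rw [← natCast_zsmul]
    exact Literature.NumberTheory.EllipticCurves.zsmul_galH1Torsion_eq_zero A (p : ℤ) s
  have hord : addOrderOf x = p := by
    have hdvd : addOrderOf x ∣ p := addOrderOf_dvd_of_nsmul_eq_zero hpx
    rcases (Nat.dvd_prime hpp).mp hdvd with h1 | h2
    · exact absurd (AddMonoid.addOrderOf_eq_one_iff.mp h1) hx0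
    · exact h2
  have hdvd : p ∣ Nat.card (A.selmerGroup (p : ℤ)) := by
    have h := addOrderOf_dvd_natCard x
    rwa [hord] at h
  exact le_antisymm hle (Nat.le_of_dvd Nat.card_pos hdvd)

/-! ## §2 SHAPE F: the auxiliary curve -/

variable (W F A₀ : WeierstrassCurve ℚ) [W.IsElliptic] [F.IsElliptic] [F.IsGloballyMinimal]
  [A₀.IsElliptic] [A₀.IsGloballyMinimal] (p : ℕ) [hp : Fact p.Prime]

/-- **SHAPE F — a third congruent curve decides the two-loss cells.** `p` odd; `E = W` of analytic
rank `0`, `E[p]` irreducible, `p ∤ #Ш_an(E)`; `A₀` globally minimal, CLOSED at `p` (`BSD(A₀,p)`),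
analytic rank `0`, `p ∤ #Ш_an(A₀)`, `A₀[p]` irreducible, GOOD at `p`; `F` globally minimal,
MULTIPLICATIVE at `p`, with equivariant `θ : E[p] ≃ F[p]` and `θ₀ : F[p] ≃ A₀[p]`. Places: for the
pair `(E, F)` finite sets `T₁ ⊆ S₁` with agreement `hagree₁` off `T₁` and a place `v₀ ∋ ℓ₀`,
`ℓ₀ ≠ p`, `p ∤ ℓ₀ − 1`, where `E` is SPLIT multiplicative and `F` GOOD (the kill place, file XIV),
budget `∏_{T₁} #E(ℚ_v)[p]·#(ℤ_v/p) ≤ p`; for the pair `(F, A₀)` finite sets `T₂ ⊆ S₂` with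
agreement `hagree₂` off `T₂ ∪ {v_p}`, budget `p · ∏_{T₂} #F(ℚ_v)[p]·#(ℤ_v/p) ≤ p`. Certificate: a
rational point `g ∈ F(ℚ)` with `#F̃(𝔽_{ℓ₀}) = reductionPointCount F ℓ₀ = p·n` and `n • red₀ g ≠ 0`
(`red₀` = the tree's reduction map of the minimal model of `F` at `v₀`). Then `BSD(E,p)`.
Binders GZK, Cassels–Tate, A40, A41, Milne I.2.8. Not a class theorem; nothing booked.
[cite: MazurRubin2004, §2.3] [cite: Miller2011LMS, §1 and Def. 1.1]
[cite: SilvermanAEC2009, Prop. VII.2.1, VIII.§2, X.§4 diagram (**), Thm X.4.2]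
[cite: SilvermanATAEC1994, Ch. V Thm. 3.1, Thm. 5.3, Cor. 5.4]
[cite: GreenbergLNM1716, §2 p. 70 and Props. 2.2, 2.4] [cite: MilneADT2006, Ch. I §2 Thm. 2.8]
[cite: GrossLMS1991, §7 (7.1)] -/
theorem bsdp_of_auxiliary_of_residue_certificate
    (hU : Silverman1994_thmV53_tateUniformisation.{0})
    (hU2 : Silverman1994_thmV53_corV54_tateUniformisation.{0})
    (hEP : ∀ v : HeightOneSpectrum (𝓞 ℚ), (p : 𝓞 ℚ) ∈ v.asIdeal →
      localEulerPoincareCharacteristic (v.adicCompletion ℚ))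
    (hGZK : rank_eq_analyticRank_of_analyticRank_le_one)
    (hCT : exists_casselsTate_pairing (K := ℚ)) (hp2 : p ≠ 2)
    (hr : W.analyticRank = 0) (hirr : Irr W p) (hSha : X11a.ShaAnUnit W p)
    (hbsdA : BSDp A₀ p) (hrA : A₀.analyticRank = 0) (hirrA : Irr A₀ p) (hShaA : X11a.ShaAnUnit A₀ p)
    (hA₀p : A₀.HasGoodReductionAtPrime p) (hFp : F.HasMultiplicativeReductionAtPrime p)
    (θ : geomTorsion W (p : ℤ) ≃+ geomTorsion F (p : ℤ))
    (hθ : ∀ (σ : absoluteGaloisGroup ℚ) (P : geomTorsion W (p : ℤ)), θ (σ • P) = σ • θ P)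
    (θ₀ : geomTorsion F (p : ℤ) ≃+ geomTorsion A₀ (p : ℤ))
    (hθ₀ : ∀ (σ : absoluteGaloisGroup ℚ) (P : geomTorsion F (p : ℤ)), θ₀ (σ • P) = σ • θ₀ P)
    -- the pair (E, F)
    (S₁ T₁ : Finset (HeightOneSpectrum (𝓞 ℚ))) (hTS₁ : T₁ ⊆ S₁)
    (hS₁ : ∀ v : HeightOneSpectrum (𝓞 ℚ), v ∉ S₁ →
      F.HasGoodReductionAt v ∧ W.HasGoodReductionAt v ∧ (p : 𝓞 ℚ) ∉ v.asIdeal)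
    (hagree₁ : ∀ v ∈ S₁, v ∉ T₁ →
      ((p : 𝓞 ℚ) ∉ v.asIdeal ∧ Nat.card (nsmulAddMonoidHom p :
          (W.baseChange (v.adicCompletion ℚ)).toAffine.Point →+ _).ker = 1) ∨
      (∀ c ∈ selmerLocalKer W (v.adicCompletion ℚ) (p : ℤ),
        h1Equiv θ hθ c ∈ selmerLocalKer F (v.adicCompletion ℚ) (p : ℤ)))
    {v₀ : HeightOneSpectrum (𝓞 ℚ)} {ℓ₀ : ℕ} [Fact ℓ₀.Prime] (hℓv₀ : (ℓ₀ : 𝓞 ℚ) ∈ v₀.asIdeal)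
    (hpv₀ : (p : 𝓞 ℚ) ∉ v₀.asIdeal) (hq : ¬ p ∣ ℓ₀ - 1)
    (hWv₀ : W.HasSplitMultiplicativeReductionAt v₀) (hFℓ : F.HasGoodReductionAtPrime ℓ₀)
    (hbudget₁ : ∏ v ∈ T₁, (Nat.card (nsmulAddMonoidHom p :
        (W.baseChange (v.adicCompletion ℚ)).toAffine.Point →+ _).ker *
          Nat.card (v.adicCompletionIntegers ℚ ⧸
            Ideal.span {(p : v.adicCompletionIntegers ℚ)})) ≤ p)
    -- the pair (F, A₀)
    (S₂ T₂ : Finset (HeightOneSpectrum (𝓞 ℚ))) (hTS₂ : T₂ ⊆ S₂)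
    (hS₂ : ∀ v : HeightOneSpectrum (𝓞 ℚ), v ∉ S₂ →
      A₀.HasGoodReductionAt v ∧ F.HasGoodReductionAt v ∧ (p : 𝓞 ℚ) ∉ v.asIdeal)
    {v₁ : HeightOneSpectrum (𝓞 ℚ)} (hpv₁ : (p : 𝓞 ℚ) ∈ v₁.asIdeal) (hv₁S : v₁ ∈ S₂) (hv₁T : v₁ ∉ T₂)
    (hagree₂ : ∀ v ∈ S₂, v ∉ T₂ → v ≠ v₁ →
      ((p : 𝓞 ℚ) ∉ v.asIdeal ∧ Nat.card (nsmulAddMonoidHom p :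
          (F.baseChange (v.adicCompletion ℚ)).toAffine.Point →+ _).ker = 1) ∨
      (∀ c ∈ selmerLocalKer F (v.adicCompletion ℚ) (p : ℤ),
        h1Equiv θ₀ hθ₀ c ∈ selmerLocalKer A₀ (v.adicCompletion ℚ) (p : ℤ)))
    (hbudget₂ : p * ∏ v ∈ T₂, (Nat.card (nsmulAddMonoidHom p :
        (F.baseChange (v.adicCompletion ℚ)).toAffine.Point →+ _).ker *
          Nat.card (v.adicCompletionIntegers ℚ ⧸
            Ideal.span {(p : v.adicCompletionIntegers ℚ)})) ≤ p)
    -- the certificate: a rational point of F not p-divisible in F(ℚ_{ℓ₀}), read in the residue field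
    {w : Valuation (AlgebraicClosure (v₀.adicCompletion ℚ)) ℝ≥0}
    (hw : ∀ x, (w x : ℝ) =
      spectralNorm (v₀.adicCompletion ℚ) (AlgebraicClosure (v₀.adicCompletion ℚ)) x)
    (red₀ : localPoints F (v₀.adicCompletion ℚ) →+
      (((integralModelInt F).map (algebraMap ℤ ↥w.valuationSubring)).map
        (IsLocalRing.residue ↥w.valuationSubring)).toAffine.Point)
    (hred₀ : ∀ P : localPoints F (v₀.adicCompletion ℚ), red₀ P =
      ((integralModelInt F).map (algebraMap ℤ ↥w.valuationSubring)).reducePoint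
        (Affine.Point.congrEquiv (localIntModel_baseChange F w.valuationSubring).symm P))
    (g : F.toAffine.Point) {n : ℕ} (hn : reductionPointCount F ℓ₀ = p * n)
    (hg : n • red₀ (pointsMap F (v₀.adicCompletion ℚ) (toGeomPoints F g)) ≠ 0) :
    BSDp W p := by
  have hpp : p.Prime := hp.out
  have hn0 : (p : ℤ) ≠ 0 := by exact_mod_cast hpp.ne_zero
  -- (1) the closed rank-0 partner: `Sel^(p)(A₀) = 0`
  have hSel₀ : Nat.card (A₀.selmerGroup (p : ℤ)) = 1 := by
    rw [natCard_selmerGroup_eq_pow_of_bsdp A₀ p hbsdA hShaA hirrA, hrA, pow_zero]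
  haveI : Finite (A₀.selmerGroup (p : ℤ)) := A₀.finite_selmerGroup_holds hn0
  have hsub₀ : ∀ d ∈ A₀.selmerGroup (p : ℤ), d = 0 := by
    intro d hd
    have h1 := (Nat.card_eq_one_iff_unique.mp hSel₀).1
    have h := @Subsingleton.elim _ h1 (⟨d, hd⟩ : A₀.selmerGroup (p : ℤ)) ⟨0, zero_mem _⟩
    exact congrArg Subtype.val h
  -- (2) `#Sel^(p)(F) ≤ p` by the strict count at `p` against `A₀` (strictness vacuous)
  obtain ⟨w₁, hw₁⟩ := v₁.exists_spectralValuation (K := ℚ)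
  haveI hV₁ : (A₀.baseChange (AlgebraicClosure (v₁.adicCompletion ℚ))).IsIntegral w₁.integer :=
    ⟨⟨(integralModelInt A₀).map (algebraMap ℤ ↥w₁.integer),
      A₀.baseChange_eq_localIntModel_integer_baseChange⟩⟩
  have hleF : Nat.card (F.selmerGroup (p : ℤ)) ≤ p :=
    (natCard_selmerGroup_le_of_agree_strict_at_p_rat F A₀ p hU2 hEP hp2 θ₀ hθ₀ S₂ T₂ hTS₂ hS₂ hpv₁
      hv₁S hv₁T hFp hA₀p hagree₂ hw₁ (fun ψ hψ _ _ _ ↦ hsub₀ _ hψ)).trans hbudget₂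
  -- (3) the certificate: `g ∉ p·F(ℚ_{ℓ₀})`, so `κ(g) ∈ Sel^(p)(F)` restricts non-trivially at `ℓ₀`
  haveI hV₀ : (F.baseChange (AlgebraicClosure (v₀.adicCompletion ℚ))).IsIntegral w.integer :=
    ⟨⟨(integralModelInt F).map (algebraMap ℤ ↥w.integer),
      F.baseChange_eq_localIntModel_integer_baseChange⟩⟩
  have hΔ : ¬ (ℓ₀ : ℤ) ∣ minimalDiscriminantInt F :=
    F.not_dvd_minimalDiscriminantInt_of_hasGoodReductionAtPrime' ℓ₀ hFℓ
  have hcert := not_zsmul_of_residue_certificate F hℓv₀ hw (F.isUnit_Δ_localIntModel hℓv₀ hw hΔ)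
    red₀ hred₀ hn g hg
  have hdiv : ∀ P : geomPoints F, ∃ Q : geomPoints F, (p : ℤ) • Q = P :=
    fun P ↦ F.zsmul_geomPoints_surjective_of_charZero hn0 P
  have hs : kummerMapTorsion F (p : ℤ) hdiv g ∈ F.selmerGroup (p : ℤ) :=
    (mem_selmerGroup_iff F _ _).mpr
      ⟨fun v ↦ kummerMapTorsion_mem_selmerLocalKer F (p : ℤ) hdiv (v.adicCompletion ℚ) g,
        fun w' ↦ kummerMapTorsion_mem_selmerLocalKer F (p : ℤ) hdiv w'.Completion g⟩
  have hres := res_kummerMapTorsion_ne_zero_of_not_zsmul F p (v₀.adicCompletion ℚ)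
    (charZero_adicCompletion v₀) hdiv g hcert
  have hSelF : Nat.card (F.selmerGroup (p : ℤ)) = p :=
    natCard_selmerGroup_eq_prime_of_le F p hleF hs (fun h0 ↦ hres (by rw [h0]; exact map_zero _))
  -- (4) the kill place `v₀`: `E` split, `F` good, `p ∤ q_{v₀} − 1`
  have hFv₀ : F.HasGoodReductionAt v₀ := F.hasGoodReductionAt_of_hasGoodReductionAtPrime v₀ hℓv₀ hFℓ
  have hq' : ¬ p ∣ Nat.card (IsLocalRing.ResidueField (v₀.adicCompletionIntegers ℚ)) - 1 := by
    rwa [WeierstrassCurve.natCard_residueField_adicCompletionIntegers v₀,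
      Rat.HeightOneSpectrum.primesEquiv_eq_of_natCast_mem v₀ Fact.out hℓv₀]
  exact bsdp_of_selmerCompanion_agree_kill W F p hGZK hCT hp2 hr hirr hSha θ hθ S₁ T₁ hTS₁ hS₁
    hagree₁
    (fun c hc hcF ↦ res_h1Equiv_eq_zero_of_split_of_good W v₀ hU F θ hθ hWv₀ hFv₀ hpv₀ hq' hc hcF)
    (fun d hd hd0 ↦ strict_away_of_generator_certificate F p (v₀.adicCompletion ℚ)
      (charZero_adicCompletion v₀) hSelF hdiv g hcert hd hd0) hbudget₁

end Summit.BirchSwinnertonDyer.Rank1Residual.X11a.SelmerCompanion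

end
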